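import Summits.AtomisticToContinuum.FouriersLaw.Theses.PhononMeanFreePath
import Summits.AtomisticToContinuum.FouriersLaw.Theorems.IncoherentChannel.Negative.LoadBearing
import Summits.AtomisticToContinuum.FouriersLaw.Theorems.IncoherentChannel.Negative.HarmonicWick

/-!
# Line `forgetting-before-hearing` for the crux `PhononMeanFreePath.IncoherentChannel` (stmt-AtomisticToContinuum-11811)

Skeleton (crux-plan, round 1, 2026-08-16; idea card `Ideas/forgetting-before-hearing.md`, triage
r1-1/2/3 all PASS with the merge `≈ two-horizons-forecast-loss ≈ common-past-variance-carrier` and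
three sharpenings, all adopted below).  Chain of `N+1` sites `0..N`, `P = pinnedChain ω₂ lam β γ`,
both baths at `T`, `μ₀ = gibbsMeasure`, `K_t = transitionKernel (N+1) T T t` (CONSTRUCTED kernels);
crux: `∃ κ > 0, N(γ²/T²)∫₀^∞[C_N − 2r_N²] → κ`.

THE LEVER.  Condition the far momentum on the INITIAL MICROSTATE `x` (average over the bath noise
only): forecast `m_t = K_t p_N`, conditional variance `v_t = K_t p_N² − m_t²`.  Law of total
variance, exactly at every `N, t` (stub 1):
  `C_N − 2r_N² = Cov_μ₀(p₀², v_t)  [HEATING]  +  {Cov_μ₀(p₀², m_t²) − 2r_N²}  [PUSH]`,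
and the conditional variance is manufactured ONLY at the two contact momenta (stub 5, the carré du
champ of the Langevin generator along the semigroup — the Liouville part is a derivation):
  `v_t(z) = 2γT ∫₀ᵗ {K_s[(∂_{p_0}K_{t−s}p_N)²](z) + K_s[(∂_{p_N}K_{t−s}p_N)²](z)} ds`.
FORGETTING BEFORE HEARING: the push term needs `m_t` to depend on `p₀`, which causality forbids
before the far contact can hear the near one (stub 4: an averaged SUB-LINEAR cone, `t ≤ N^θ`,
`θ < 1`), while after that the far contact has forgotten the whole initial microstate (stub 3: the
N-UNIFORM forecast-loss envelope `‖K_tp_N‖₂² + ‖K_tp_N‖₄² ≤ C(1+t)^{-a}`, `a > 2`); with the fixed-`N`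
Cauchy–Schwarz envelope `|push| ≤ 2T‖m_t‖₂² + √2·T‖m_t‖₄²` (stub 2) this gives `N∫|push| → 0`
— PROVED here (`pushNegligible_of`, real analysis with the crossover `θ := (1 + 1/(a−1))/2`).  What
is left is the HEATING LIMIT (stub 6, the transport core, conceded Fourier-strength by the card and
all three triagers): `N(γ²/T²)∫Cov(p₀², v_t) → κ > 0`, to be attacked through the positive contact
thermometers of stub 5 (which is why stub 6 takes stub 5's statement as its hypothesis).

STUBS (6; `sorry` only inside `stub_*`; sizes are guesses):
* `stub_totalVarianceSplit`   (B1) fixed `N,t`: `cumulantChannel = heating + push` — linearity of the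
  Bochner integral + four Gibbs-integrability facts (kernel moment bounds `Negative.KernelMoments`). S/M.
* `stub_pushEnvelope`         (B2) fixed `N`: `t ↦ push_N(t)` a.e.-strongly measurable on `(0,∞)` and
  `|push(t)| ≤ 2T·S_N(t) + √2·T·√S4_N(t)` (Cauchy–Schwarz in `L²(μ₀)`, `E p₀² = T`, `E(p₀²−T)² = 2T²`). M.
* `stub_forecastEnvelope`     (F′) N-UNIFORM: `∃ C, a > 2, ∀ N t, S_N(t) + √S4_N(t) ≤ C(1+t)^{-a}`,
  `S_N = ‖K_tp_N‖²_{L²(μ₀)}`, `S4_N = ‖K_tp_N‖⁴_{L⁴}` — the load-bearing NEW input (polynomial form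
  = triage sharpen r1-2/r1-3; FALSE at `lam = β = 0`, where `S_N` plateaus until `t ≈ N/v`). XL.
* `stub_sublinearCone`        (L) `∀ θ ∈ (0,1): N∫_{(0,N^θ]}|push_N| → 0` — averaged almost-linear light
  cone in integrated form (triage sharpen r1-1(v): NOT Buttà–Marchioro's pathwise statement; true and
  trivial at the harmonic corner where `push ≡ 0`). L.
* `stub_contactLeibnizDefect` (B3) fixed `N,t,z`: the contact representation of `v_t` above (Dynkin +
  hypoelliptic regularity of `K_u p_N` at fixed `N`; Bakry–Émery variance-Duhamel formula). M/L.
* `stub_heatingLimit`         (H) `ContactLeibnizDefect → (∃ κ > 0, heating_N ∈ L¹(0,∞) ∀N ∧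
  N(γ²/T²)∫heating_N → κ)` — HARDEST (open-problem strength: under stubs 1–4 it is EQUIVALENT to the
  crux, hence to `BoundaryKubo`'s `D_N → κ`, cf. `Negative.LoadBearing.incoherentChannel_iff_fouriersLaw`).
`IncoherentChannel_of : Sig₁ → … → Sig₆ → IncoherentChannel` is sorry-free (`pushNegligible_of` +
`heatingReduction` + `crux_iff = Iff.rfl`); the final `example` applies it to the six sorried stubs.
Convention (as `Cruxes/SomeWindowSaving/Lines/inert-box-collapse.lean`): each statement is a named
`Prop`, the registered obligation `theorem stub_<x> : <body verbatim> := by sorry`, `<x>_holds`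
certifies the agreement definitionally, `Registered.stub_<x>` are the name-keyed aliases used as the
hypotheses of the composition (the skeleton audit admits a hypothesis by the last component of its head).

DISPROOF USED (`Cruxes/IncoherentChannel/Disproof.lean`, cdisprove gen 1 §0–§5; landed
`Theorems/IncoherentChannel/Negative/{LoadBearing, UnitTemperature, HarmonicFlow, KernelMoments,
GibbsStein, HarmonicWick}` — the first and last imported here so the scratch check sees them):
* `crux_false_without_anharmonicity` / `not_crux_at_harmonic` (HarmonicWick, PROVED: `C_N ≡ 2r_N²` at
  `lam = β = 0`): honoured at `stub_forecastEnvelope` (FALSE at the corner: `∫₀^∞S_N ∝ N`, MD j011153/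
  j011196 harmonic control) and at `stub_heatingLimit` (FALSE at the corner: `v_t` deterministic by
  Kalman, `heating ≡ 0`, `κ > 0` fails); stubs 1, 2, 4, 5 hold at the corner (4 trivially, `push ≡ 0`)
  — so the line uses `lam, β > 0` exactly where the disproof says it must, and nowhere vacuously.
* `crux_false_without_gammaPos` / `_TPos` (LoadBearing): `γ > 0` enters through the factor `2γT` of
  stub 5 and through stub 3 (at `γ = 0`, `K_t p_N = p_N ∘ Φ_t` and `S_N ≡ T` does not decay); `T > 0`
  through the Maxwellian moments in stub 2 and the prefactor of stub 6.
* `incoherentChannel_iff_fouriersLaw` (LoadBearing §3, costume yardstick): stub 6 is conceded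
  transport-strength; the line's new, N-uniform, single-contact content is stubs 3–4 (+ the exact
  re-cutting 1, 2, 5), which ALSO closes the sibling crux `CoherentDephasing` (11810):
  `|r_N| ≤ √T·‖K_tp_N‖₂` outside the cone (not needed here, recorded in the line card).
* `incoherentChannel_iff_unit_temperature` (UnitTemperature §4): every stub is covariant under the
  proved amplitude scaling `(q,p) ↦ (sq,sp)` (`skill ↦ s²`, `skill4 ↦ s⁴`, `push, heating ↦ s⁴`,
  `(1+t)^{-a}` and `∂_{p_b}K_up_N` invariant), so WLOG `T = 1` for every stub.
* `At.eventually_integrableOn` (LoadBearing §1, hidden fixed-`N` integrability): supplied explicitly —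
  `push_N ∈ L¹(0,∞)` is DERIVED in `pushNegligible_of` from stubs 2–3, `heating_N ∈ L¹` is a conjunct
  of stub 6; nothing can be junk-true.
No `-- Targets` section / stub kill exists yet for this line (Disproof read 2026-08-16T05:40Z).
`ledger negatives` (12): the only FouriersLaw entry (DiluteCellGaussianiser FarFieldGaussianity,
`harmonicHostWithCell`) is not instantiated by any stub (all objects are the pinnedChain kernels).

TRIAGE ANSWERS: r1-1(v) `ContactCausality` (linear cone, exp tails, "transplant of BM Thm 2.2") was a
NEW claim → replaced by the weaker integrated sub-linear cone (stub 4), which the proved composition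
shows is enough once `a > 2`; r1-2/r1-3 "uniform exponential ∀t is more than needed" → stub 3 is the
polynomial envelope `a > 2` (+ the `L⁴` analogue the Cauchy–Schwarz step needs); r1-2 Addendum "horizon
`t_f ≈ ℓ/v ≈ 30` at `lam·T = 1`, not `1/γ`" → no rate is asserted, only an integrable N-uniform
envelope (constants free); r1-1 "state over `N ≥ 2` (dimer `B₁ < 0` at `0⁺`)" → moot: no SIGN of
`heating` or `push` is asserted anywhere (limits and envelopes only); the failed sibling
`depolarised-wake-positivity` (pointwise sign of `w_N`) shares nothing with this stub set.
-/

noncomputable section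

open MeasureTheory Filter Topology Set
open scoped NNReal

namespace Summit.AtomisticToContinuum.FouriersLaw.Cruxes.IncoherentChannel.ForgettingBeforeHearing

open Literature.MathematicalPhysics.KineticTheory.HeatConduction
open Summit.AtomisticToContinuum.FouriersLaw.Theses.PhononMeanFreePath

/-! ## Vocabulary (chain of `N+1` sites `0..N`, both baths at `T`; all integrals over the tree's
CONSTRUCTED objects `pinnedChain`, `OscillatorChain.transitionKernel`, `OscillatorChain.gibbsMeasure`) -/

variable (ω₂ lam β γ : ℝ) (N : ℕ) (T : ℝ)

/-- Equal-temperature transition kernel `K_t(z, ·)` of the `(N+1)`-site chain. -/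
abbrev K (t : ℝ) (z : PhaseSpace (N + 1)) : Measure (PhaseSpace (N + 1)) :=
  (pinnedChain ω₂ lam β γ).transitionKernel (N + 1) T T t.toNNReal z

/-- Gibbs measure `μ₀` of the `(N+1)`-site chain at temperature `T`. -/
abbrev μ : Measure (PhaseSpace (N + 1)) := (pinnedChain ω₂ lam β γ).gibbsMeasure (N + 1) T

/-- FORECAST of the far momentum from the initial microstate: `m_t(z) = (K_t p_N)(z) = E[p_N(t) | X₀ = z]`. -/
def forecast (t : ℝ) (z : PhaseSpace (N + 1)) : ℝ :=
  ∫ y, y.2 (Fin.last N) ∂(K ω₂ lam β γ N T t z)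

/-- Forecast of the far kinetic energy: `(K_t p_N²)(z)`. -/
def forecastSq (t : ℝ) (z : PhaseSpace (N + 1)) : ℝ :=
  ∫ y, (y.2 (Fin.last N)) ^ 2 ∂(K ω₂ lam β γ N T t z)

/-- CONDITIONAL VARIANCE of the far momentum given the initial microstate:
`v_t(z) = Var(p_N(t) | X₀ = z) = K_t p_N²(z) − (K_t p_N(z))²`. -/
def condVar (t : ℝ) (z : PhaseSpace (N + 1)) : ℝ :=
  forecastSq ω₂ lam β γ N T t z - forecast ω₂ lam β γ N T t z ^ 2

/-- `r_N(t) = ∫ p₀ · K_t p_N dμ₀` — the crux's two-point function, verbatim. -/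
def rN (t : ℝ) : ℝ := ∫ z, z.2 0 * forecast ω₂ lam β γ N T t z ∂(μ ω₂ lam β γ N T)

/-- `C_N(t) = Cov_μ₀(p₀², K_t p_N²)` — the crux's four-point function, verbatim. -/
def CN (t : ℝ) : ℝ :=
  (∫ z, (z.2 0) ^ 2 * forecastSq ω₂ lam β γ N T t z ∂(μ ω₂ lam β γ N T)) -
    (∫ z, (z.2 0) ^ 2 ∂(μ ω₂ lam β γ N T)) * (∫ z, forecastSq ω₂ lam β γ N T t z ∂(μ ω₂ lam β γ N T))

/-- The crux's integrand, the cumulant ("incoherent") channel `C_N(t) − 2 r_N(t)²`. -/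
def cumulantChannel (t : ℝ) : ℝ := CN ω₂ lam β γ N T t - 2 * rN ω₂ lam β γ N T t ^ 2

/-- HEATING part of the channel: `Cov_μ₀(p₀², v_t)`. -/
def heating (t : ℝ) : ℝ :=
  (∫ z, (z.2 0) ^ 2 * condVar ω₂ lam β γ N T t z ∂(μ ω₂ lam β γ N T)) -
    (∫ z, (z.2 0) ^ 2 ∂(μ ω₂ lam β γ N T)) * (∫ z, condVar ω₂ lam β γ N T t z ∂(μ ω₂ lam β γ N T))

/-- PUSH part of the channel: `Cov_μ₀(p₀², m_t²) − 2 r_N²`. -/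
def push (t : ℝ) : ℝ :=
  (∫ z, (z.2 0) ^ 2 * forecast ω₂ lam β γ N T t z ^ 2 ∂(μ ω₂ lam β γ N T)) -
    (∫ z, (z.2 0) ^ 2 ∂(μ ω₂ lam β γ N T)) * (∫ z, forecast ω₂ lam β γ N T t z ^ 2 ∂(μ ω₂ lam β γ N T)) -
    2 * rN ω₂ lam β γ N T t ^ 2

/-- FORECAST SKILL `S_N(t) = ‖K_t p_N‖²_{L²(μ₀)}` (two-replica reading: `E[p_N⁽¹⁾(t) p_N⁽²⁾(t)]` for two
copies with common initial data and independent bath noises). -/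
def skill (t : ℝ) : ℝ := ∫ z, forecast ω₂ lam β γ N T t z ^ 2 ∂(μ ω₂ lam β γ N T)

/-- Fourth moment of the forecast, `‖K_t p_N‖⁴_{L⁴(μ₀)}`. -/
def skill4 (t : ℝ) : ℝ := ∫ z, forecast ω₂ lam β γ N T t z ^ 4 ∂(μ ω₂ lam β γ N T)

/-- Propagated squared CONTACT SENSITIVITY of the far forecast: `K_s[(∂_{p_b} K_u p_N)²](z)`. -/
def sensitivity (b : Fin (N + 1)) (s u : ℝ) (z : PhaseSpace (N + 1)) : ℝ :=
  ∫ y, (partialP b (forecast ω₂ lam β γ N T u) y) ^ 2 ∂(K ω₂ lam β γ N T s z)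

/-- The crux written through `cumulantChannel` (NOT a new statement: `crux_iff` is `Iff.rfl`). -/
def CruxViaChannel : Prop :=
  ∀ ω₂ lam β γ : ℝ, 0 < ω₂ → 0 < lam → 0 < β → 0 < γ → ∀ T : ℝ, 0 < T → ∃ κ : ℝ, 0 < κ ∧
    Tendsto (fun N : ℕ => (N : ℝ) * (γ ^ 2 / T ^ 2) *
      ∫ t in Ioi (0 : ℝ), cumulantChannel ω₂ lam β γ N T t) atTop (𝓝 κ)

/-- The vocabulary is pinned to the crux DEFINITIONALLY. -/
theorem crux_iff : CruxViaChannel ↔ IncoherentChannel := Iff.rfl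

/-! ## The statements of the line -/

/-- (B1) TOTAL-VARIANCE SPLIT of the cumulant channel (fixed `N`, `t > 0`):
`Cov(p₀², K_tp_N²) = Cov(p₀², v_t) + Cov(p₀², m_t²)` since `K_tp_N² = v_t + m_t²`; needs only the
`μ₀`-integrability of `p₀²·K_tp_N²`, `p₀²·m_t²`, `K_tp_N²`, `m_t²` (kernel energy/moment bounds:
`Negative.KernelMoments.integrable_sq_momentum_transitionKernel`, `integrable_exp_hamiltonian_transitionKernel`,
Gibbs exponential moments `pinnedChain_integrable_exp_mul_hamiltonian_gibbsMeasure`). [folklore] -/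
def TotalVarianceSplit : Prop :=
  ∀ ω₂ lam β γ : ℝ, 0 < ω₂ → 0 < lam → 0 < β → 0 < γ → ∀ T : ℝ, 0 < T → ∀ (N : ℕ) (t : ℝ), 0 < t →
    cumulantChannel ω₂ lam β γ N T t = heating ω₂ lam β γ N T t + push ω₂ lam β γ N T t

/-- (B2) PUSH ENVELOPE (fixed `N`): measurability in `t` and the Cauchy–Schwarz bound
`|push(t)| ≤ 2T‖m_t‖₂² + √2·T·‖m_t‖₄²`.  Proof sketch: `μ₀` is a probability measure with `p₀ ~ N(0,T)`
exactly (`Negative.GibbsStein.gibbs_sq_momentum`: `E p₀² = T`; `E p₀⁴ = 3T²`), so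
`Cov(p₀², m_t²) = E[(p₀² − T)m_t²]`, `|·| ≤ ‖p₀² − T‖₂‖m_t²‖₂ = √2·T·(∫m_t⁴)^{1/2}`, and
`r_N² = E[p₀m_t]² ≤ T·∫m_t²`; finiteness of `∫m_t⁴` by conditional Jensen `m_t⁴ ≤ K_tp_N⁴` and Gibbs
invariance of the kernels (`pinnedChain_gibbsMeasure_bind_transitionKernel`, landed in
`Theorems/BondHeatUncertaintySubdiffusiveBondHeatKernelGibbsD`); measurability of `t ↦ push(t)` from the
joint measurability of `(t,z) ↦ K_t(z,·)` (`pinnedChain_measurable_transitionKernel`). [folklore] -/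
def PushEnvelope : Prop :=
  ∀ ω₂ lam β γ : ℝ, 0 < ω₂ → 0 < lam → 0 < β → 0 < γ → ∀ T : ℝ, 0 < T → ∀ N : ℕ,
    AEStronglyMeasurable (push ω₂ lam β γ N T) (volume.restrict (Ioi (0 : ℝ))) ∧
    ∀ t : ℝ, 0 < t →
      |push ω₂ lam β γ N T t| ≤
        2 * T * skill ω₂ lam β γ N T t + Real.sqrt 2 * T * Real.sqrt (skill4 ω₂ lam β γ N T t)

/-- (F′) FORECAST ENVELOPE — the load-bearing N-UNIFORM input: the far contact momentum is
unforecastable from the ENTIRE initial microstate after an `N`-independent time, with an integrable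
polynomial envelope `S_N(t) + √S4_N(t) ≤ C(1+t)^{-a}`, `a > 2` (weaker than the card's uniform
exponential; triage sharpen).  Why plausibly true: `S_N(t) = −⟨p_N, K_tΘK_tp_N⟩_μ₀` (`K_t† = ΘK_tΘ`,
`Θ` = momentum reversal) is a noisy Loschmidt echo of ONE contact observable that is odd under the
global flip `S : (q,p) ↦ (−q,−p)` (a symmetry of `μ₀` and of the dynamics in law, `U, V` even), hence
orthogonal at all orders to the slow (S-even) energy field and its products, so neither
`SpectralGapClosingEquilibrium.rate_le_of_slowObservable` nor Mazur (no S-odd conserved charge once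
the chain is pinned) bites; `dS_N/dt = −2γTΣ_b‖∂_{p_b}K_tp_N‖²` (budget `T`); fixed-`N` exponential
decay from CEHR 2018 weighted ergodicity; MD (kit j011153/j011193, `lam·T = β·T = 1`, `n = 8…64`):
pre-cutoff curves for `n = 32, 64` coincide within ±0.01 and decay (`S_N/T ≈ 0.25e^{-t/30}`), harmonic
control flat at 0.15 until `t ≈ n/0.6` (`∫S ∝ n`).  Why it might fail: a slow S-odd mode with `O(1)`
weight in `p_N` uniformly in `N`; FALSE at `lam = β = 0` and at `γ = 0` (informative direction).
Constants `C, a` may blow up as `lam·T, β·T → 0` (horizon `≍ ℓ(lam·T)/v`, `ℓ ≈ 30` sites at 1,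
`≈ 105/v` at 0.3): only `N → ∞` at fixed parameters is claimed. [conjecture of this line] -/
def ForecastEnvelope : Prop :=
  ∀ ω₂ lam β γ : ℝ, 0 < ω₂ → 0 < lam → 0 < β → 0 < γ → ∀ T : ℝ, 0 < T → ∃ C a : ℝ, 2 < a ∧
    ∀ (N : ℕ) (t : ℝ), 0 ≤ t →
      skill ω₂ lam β γ N T t + Real.sqrt (skill4 ω₂ lam β γ N T t) ≤ C * (1 + t) ^ (-a)

/-- (L) SUB-LINEAR CONE for the push term (averaged causality, integrated form): for every
`θ ∈ (0,1)`, `N∫_{(0,N^θ]}|push_N(t)|dt → 0`.  Why plausibly true: `push = 2T²Var_μ₀(∂_{p₀}m_t) +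
2T²E[m_t∂²_{p₀}m_t]` (Hermite-2 Stein in `p₀ ~ N(0,T)`, independent of the rest under `μ₀`) measures the
`p₀`-dependence of the far forecast, i.e. the noise-averaged first/second variation `0 → N` of the flow;
its iterated-Duhamel expansion over nearest-neighbour paths of length `≥ 2N` is bounded in Gibbs mean
by `(e·C·t/2N)^{2N}`-type terms (all moments of `V″(r_i) = 1 + 3βr_i²`, `U″` are finite under `μ₀`
and along the stationary dynamics), super-polynomially small for `t ≤ N^θ`; the almost-linear cone
`|i−j| ≤ t·log^α t` of Buttà–Marchioro 2016 Thm 2.2 (`ButtaMarchioro2016_thm22_chain`, infinite chain,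
pathwise) is the model, NOT the statement (open chain, baths, Gibbs AVERAGE: a new but soft claim).
TRUE and trivial at `lam = β = 0` (`push ≡ 0`: linear forecast with deterministic coefficient).
Stated for all `θ < 1` because the composition needs `θ > 1/(a−1)` with only `a > 2` known from (F′).
[conjecture of this line; cite: ButtaMarchioro2016 Thm 2.2 for the mechanism] -/
def SublinearCone : Prop :=
  ∀ ω₂ lam β γ : ℝ, 0 < ω₂ → 0 < lam → 0 < β → 0 < γ → ∀ T : ℝ, 0 < T → ∀ θ : ℝ, 0 < θ → θ < 1 →
    Tendsto (fun N : ℕ => (N : ℝ) * ∫ t in Ioc (0 : ℝ) ((N : ℝ) ^ θ), |push ω₂ lam β γ N T t|)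
      atTop (𝓝 0)

/-- (B3) CONTACT LEIBNIZ DEFECT: the conditional variance is manufactured only at the two contact
momenta (carré du champ of the Langevin generator along the semigroup).  With `g_s := K_{t−s}p_N` and
`φ(s) := K_s[g_s²](z)`: `φ(t) − φ(0) = v_t(z)` and `φ′(s) = K_s[L(g_s²) − 2g_sLg_s] = 2K_sΓ(g_s)`,
`Γ(f) = γT[(∂_{p_0}f)² + (∂_{p_N}f)²]` for the tree's `OscillatorChain.generator` (Liouville part a
derivation, friction first order; for `N = 0` both bath terms sit on the single site and the two
summands below coincide, which is exactly right).  Fixed-`N`, theorem-grade (Bakry–Gentil–Ledoux 2014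
§4.7 variance Duhamel; needs `C²`-regularity with moment control of `u ↦ K_up_N` in the two noise
directions: hypoelliptic smoothing at fixed `N`, `LangevinChainHormander`, `langevin_backwardEquation`,
`pinnedChain_dynkin`, Chapman–Kolmogorov `pinnedChain_transitionKernel_add`). Every term is a genuine
(finite) integral: kernel moments are finite from EVERY starting point (`Negative.KernelMoments`).
[cite: BakryGentilLedoux2014 §4.7; folklore for this generator] -/
def ContactLeibnizDefect : Prop :=
  ∀ ω₂ lam β γ : ℝ, 0 < ω₂ → 0 < lam → 0 < β → 0 < γ → ∀ T : ℝ, 0 < T → ∀ (N : ℕ) (t : ℝ), 0 < t →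
    ∀ z : PhaseSpace (N + 1), condVar ω₂ lam β γ N T t z =
      2 * γ * T * ∫ s in (0 : ℝ)..t,
        (sensitivity ω₂ lam β γ N T 0 s (t - s) z + sensitivity ω₂ lam β γ N T (Fin.last N) s (t - s) z)

/-- (H) HEATING LIMIT: the heating part carries the whole conductivity —
`heating_N ∈ L¹(0,∞)` for every `N` and `N(γ²/T²)∫₀^∞Cov_μ₀(p₀², v_t)dt → κ > 0`.  This is the
transport core in new clothes (HONEST: under stubs 1–4 it is EQUIVALENT to the crux, hence — with
`NessUnique`, `BoundaryKubo`, `CoherentDephasing` — to Fourier's law in Kubo form, Disproof §3).  Why the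
clothes are better (card, Transfer (a)/(e)): the cumulant's subtraction is gone; through stub 5,
`heating(t) = 2γT Σ_b ∫₀ᵗ Cov_μ₀(p₀², K_s g^b_{t−s}) ds` with the NONNEGATIVE local thermometers
`g^b_u = (∂_{p_b}K_up_N)²` — heat arrival from contact `0` read at contact `N` by positive functionals
whose thermometric coefficients vanish identically iff the chain is harmonic — so `κ > 0` becomes
"arriving heat raises the far contact's noise susceptibility on average" instead of the sign of a
difference of two `O(1)` channels.  FALSE at `lam = β = 0` (Kalman: `v_t` deterministic, `heating ≡ 0`)
and at `γ = 0`.  Why it might fail: exactly as the crux (Green–Kubo depth: existence of the limit AND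
positivity over diffusive times `t ~ N²`; an S-odd hidden charge). [conjecture = transport core;
cite: BonettoLebowitzReyBellet2000 §5–6, KunduDharNarayan2009] -/
def HeatingLimit : Prop :=
  ∀ ω₂ lam β γ : ℝ, 0 < ω₂ → 0 < lam → 0 < β → 0 < γ → ∀ T : ℝ, 0 < T → ∃ κ : ℝ, 0 < κ ∧
    (∀ N : ℕ, IntegrableOn (heating ω₂ lam β γ N T) (Ioi 0)) ∧
    Tendsto (fun N : ℕ => (N : ℝ) * (γ ^ 2 / T ^ 2) * ∫ t in Ioi (0 : ℝ), heating ω₂ lam β γ N T t)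
      atTop (𝓝 κ)

/-- (X) PUSH NEGLIGIBLE: the push part is `o(1/N)` after time integration — NOT a stub: DERIVED below
(`pushNegligible_of`) from (B2) ∧ (F′) ∧ (L).  TRUE at the harmonic corner (`push ≡ 0`), so it is not
a strengthening of `CoherentDephasing`. -/
def PushNegligible : Prop :=
  ∀ ω₂ lam β γ : ℝ, 0 < ω₂ → 0 < lam → 0 < β → 0 < γ → ∀ T : ℝ, 0 < T →
    (∀ N : ℕ, IntegrableOn (push ω₂ lam β γ N T) (Ioi 0)) ∧
    Tendsto (fun N : ℕ => (N : ℝ) * ∫ t in Ioi (0 : ℝ), push ω₂ lam β γ N T t) atTop (𝓝 0)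

/-! ## The registered stubs (`sorry` lives only in these six theorems) -/

/-- **STUB 1 · `stub_totalVarianceSplit`** (= `TotalVarianceSplit` verbatim; size S/M; provable now). -/
theorem stub_totalVarianceSplit :
    ∀ ω₂ lam β γ : ℝ, 0 < ω₂ → 0 < lam → 0 < β → 0 < γ → ∀ T : ℝ, 0 < T → ∀ (N : ℕ) (t : ℝ), 0 < t →
      cumulantChannel ω₂ lam β γ N T t = heating ω₂ lam β γ N T t + push ω₂ lam β γ N T t := by
  sorry

/-- **STUB 2 · `stub_pushEnvelope`** (= `PushEnvelope` verbatim; size M; provable now). -/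
theorem stub_pushEnvelope :
    ∀ ω₂ lam β γ : ℝ, 0 < ω₂ → 0 < lam → 0 < β → 0 < γ → ∀ T : ℝ, 0 < T → ∀ N : ℕ,
      AEStronglyMeasurable (push ω₂ lam β γ N T) (volume.restrict (Ioi (0 : ℝ))) ∧
      ∀ t : ℝ, 0 < t →
        |push ω₂ lam β γ N T t| ≤
          2 * T * skill ω₂ lam β γ N T t + Real.sqrt 2 * T * Real.sqrt (skill4 ω₂ lam β γ N T t) := by
  sorry

/-- **STUB 3 · `stub_forecastEnvelope`** (= `ForecastEnvelope` verbatim; size XL; the load-bearing NEW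
N-uniform input — most informative stub; false at the harmonic corner). -/
theorem stub_forecastEnvelope :
    ∀ ω₂ lam β γ : ℝ, 0 < ω₂ → 0 < lam → 0 < β → 0 < γ → ∀ T : ℝ, 0 < T → ∃ C a : ℝ, 2 < a ∧
      ∀ (N : ℕ) (t : ℝ), 0 ≤ t →
        skill ω₂ lam β γ N T t + Real.sqrt (skill4 ω₂ lam β γ N T t) ≤ C * (1 + t) ^ (-a) := by
  sorry

/-- **STUB 4 · `stub_sublinearCone`** (= `SublinearCone` verbatim; size L; averaged causality). -/
theorem stub_sublinearCone :
    ∀ ω₂ lam β γ : ℝ, 0 < ω₂ → 0 < lam → 0 < β → 0 < γ → ∀ T : ℝ, 0 < T → ∀ θ : ℝ, 0 < θ → θ < 1 →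
      Tendsto (fun N : ℕ => (N : ℝ) * ∫ t in Ioc (0 : ℝ) ((N : ℝ) ^ θ), |push ω₂ lam β γ N T t|)
        atTop (𝓝 0) := by
  sorry

/-- **STUB 5 · `stub_contactLeibnizDefect`** (= `ContactLeibnizDefect` verbatim; size M/L; fixed-`N`
theorem-grade). -/
theorem stub_contactLeibnizDefect :
    ∀ ω₂ lam β γ : ℝ, 0 < ω₂ → 0 < lam → 0 < β → 0 < γ → ∀ T : ℝ, 0 < T → ∀ (N : ℕ) (t : ℝ), 0 < t →
      ∀ z : PhaseSpace (N + 1), condVar ω₂ lam β γ N T t z =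
        2 * γ * T * ∫ s in (0 : ℝ)..t,
          (sensitivity ω₂ lam β γ N T 0 s (t - s) z +
            sensitivity ω₂ lam β γ N T (Fin.last N) s (t - s) z) := by
  sorry

/-- **STUB 6 · `stub_heatingLimit`** (= `ContactLeibnizDefect → HeatingLimit` verbatim; HARDEST —
open-problem strength, the transport core; takes stub 5's statement as hypothesis because the
positive-thermometer representation it provides is the intended way in). -/
theorem stub_heatingLimit :
    ContactLeibnizDefect →
    ∀ ω₂ lam β γ : ℝ, 0 < ω₂ → 0 < lam → 0 < β → 0 < γ → ∀ T : ℝ, 0 < T → ∃ κ : ℝ, 0 < κ ∧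
      (∀ N : ℕ, IntegrableOn (heating ω₂ lam β γ N T) (Ioi 0)) ∧
      Tendsto (fun N : ℕ => (N : ℝ) * (γ ^ 2 / T ^ 2) * ∫ t in Ioi (0 : ℝ), heating ω₂ lam β γ N T t)
        atTop (𝓝 κ) := by
  sorry

/-! ### Consistency: each named statement IS its registered stub (definitionally) -/

theorem totalVarianceSplit_holds : TotalVarianceSplit := stub_totalVarianceSplit
theorem pushEnvelope_holds : PushEnvelope := stub_pushEnvelope
theorem forecastEnvelope_holds : ForecastEnvelope := stub_forecastEnvelope
theorem sublinearCone_holds : SublinearCone := stub_sublinearCone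
theorem contactLeibnizDefect_holds : ContactLeibnizDefect := stub_contactLeibnizDefect
theorem heatingLimit_holds : ContactLeibnizDefect → HeatingLimit := stub_heatingLimit

/-! ### Name-keyed aliases of the six statements (the hypotheses of the composition) -/
namespace Registered

/-- Alias of `TotalVarianceSplit` keyed by the registered stub name. -/
abbrev stub_totalVarianceSplit : Prop := TotalVarianceSplit
/-- Alias of `PushEnvelope` keyed by the registered stub name. -/
abbrev stub_pushEnvelope : Prop := PushEnvelope
/-- Alias of `ForecastEnvelope` keyed by the registered stub name. -/
abbrev stub_forecastEnvelope : Prop := ForecastEnvelope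
/-- Alias of `SublinearCone` keyed by the registered stub name. -/
abbrev stub_sublinearCone : Prop := SublinearCone
/-- Alias of `ContactLeibnizDefect` keyed by the registered stub name. -/
abbrev stub_contactLeibnizDefect : Prop := ContactLeibnizDefect
/-- Alias of `ContactLeibnizDefect → HeatingLimit` keyed by the registered stub name. -/
abbrev stub_heatingLimit : Prop := ContactLeibnizDefect → HeatingLimit

end Registered

/-! ## Proved glue, part 1: FORGETTING BEFORE HEARING — (B2) ∧ (F′) ∧ (L) ⇒ (X) -/

/-- The skill is non-negative (it is `∫ m_t² dμ₀`). -/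
theorem skill_nonneg (t : ℝ) : 0 ≤ skill ω₂ lam β γ N T t :=
  integral_nonneg fun _ => sq_nonneg _

/-- Elementary: for `0 < c` and `2 < a`, `∫_{t > c} t^{-a} dt = c^{1-a}/(a-1)`, and the scaled tail
`N · (N^θ)^{1-a}/(a-1) = N^{-(θ(a-1)-1)}/(a-1)`. Packaged as the limit used below. -/
theorem tendsto_tail_aux {a θ M : ℝ} (hθa : 1 < θ * (a - 1)) :
    Tendsto (fun N : ℕ => M / (a - 1) * (N : ℝ) ^ (-(θ * (a - 1) - 1))) atTop (𝓝 0) := by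
  have h : Tendsto (fun N : ℕ => (N : ℝ) ^ (-(θ * (a - 1) - 1))) atTop (𝓝 0) :=
    (tendsto_rpow_neg_atTop (by linarith)).comp tendsto_natCast_atTop_atTop
  simpa using h.const_mul (M / (a - 1))

/-- **Push disposal by causality × forgetting.** From the fixed-`N` envelope (B2), the N-uniform
forecast loss (F′) with exponent `a > 2` and the sub-linear cone (L) at `θ ∈ (1/(a-1), 1)`:
`N∫|push| ≤ N∫_{(0,N^θ]}|push| + N·M·(N^θ)^{1-a}/(a-1) → 0`. -/
theorem pushNegligible_of (h2 : PushEnvelope) (h3 : ForecastEnvelope) (h4 : SublinearCone) :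
    PushNegligible := by
  intro ω₂ lam β γ hω hl hβ hγ T hT
  obtain ⟨C, a, ha, hC⟩ := h3 ω₂ lam β γ hω hl hβ hγ T hT
  -- the envelope constant
  set M : ℝ := (2 * T + Real.sqrt 2 * T) * C with hM
  have hC0 : 0 ≤ C := by
    have h := hC 0 0 le_rfl
    have h1 : (0 : ℝ) ≤ skill ω₂ lam β γ 0 T 0 + Real.sqrt (skill4 ω₂ lam β γ 0 T 0) :=
      add_nonneg (skill_nonneg ω₂ lam β γ 0 T 0) (Real.sqrt_nonneg _)
    simpa using h1.trans h
  have hT2 : 0 ≤ 2 * T + Real.sqrt 2 * T := by positivity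
  have hM0 : 0 ≤ M := mul_nonneg hT2 hC0
  -- pointwise envelope on `t > 0`
  have hpt : ∀ (N : ℕ) (t : ℝ), 0 < t → |push ω₂ lam β γ N T t| ≤ M * (1 + t) ^ (-a) := by
    intro N t ht
    have hb := (h2 ω₂ lam β γ hω hl hβ hγ T hT N).2 t ht
    have hs0 := skill_nonneg ω₂ lam β γ N T t
    have hq0 : 0 ≤ Real.sqrt (skill4 ω₂ lam β γ N T t) := Real.sqrt_nonneg _
    have hstep : 2 * T * skill ω₂ lam β γ N T t + Real.sqrt 2 * T * Real.sqrt (skill4 ω₂ lam β γ N T t) ≤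
        (2 * T + Real.sqrt 2 * T) * (skill ω₂ lam β γ N T t + Real.sqrt (skill4 ω₂ lam β γ N T t)) := by
      have h2T : 0 ≤ 2 * T := by positivity
      have hsT : 0 ≤ Real.sqrt 2 * T := by positivity
      nlinarith [mul_nonneg h2T hq0, mul_nonneg hsT hs0]
    calc |push ω₂ lam β γ N T t|
        ≤ 2 * T * skill ω₂ lam β γ N T t + Real.sqrt 2 * T * Real.sqrt (skill4 ω₂ lam β γ N T t) := hb
      _ ≤ (2 * T + Real.sqrt 2 * T) * (skill ω₂ lam β γ N T t + Real.sqrt (skill4 ω₂ lam β γ N T t)) := hstep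
      _ ≤ (2 * T + Real.sqrt 2 * T) * (C * (1 + t) ^ (-a)) :=
          mul_le_mul_of_nonneg_left (hC N t ht.le) hT2
      _ = M * (1 + t) ^ (-a) := by rw [hM]; ring
  -- a cruder envelope on `t > 0`: `M t^{-a}`
  have hpt' : ∀ (N : ℕ) (t : ℝ), 0 < t → |push ω₂ lam β γ N T t| ≤ M * t ^ (-a) := by
    intro N t ht
    refine (hpt N t ht).trans (mul_le_mul_of_nonneg_left ?_ hM0)
    exact Real.rpow_le_rpow_of_nonpos ht (by linarith) (by linarith)
  -- fixed-`N` integrability on `(0, ∞)` from measurability + the integrable envelope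
  have hint : ∀ N : ℕ, IntegrableOn (push ω₂ lam β γ N T) (Ioi 0) := by
    intro N
    have hG : Integrable (fun t : ℝ => M * (1 + ‖t‖) ^ (-a)) (volume.restrict (Ioi (0 : ℝ))) := by
      have h1 : Integrable (fun t : ℝ => (1 + ‖t‖) ^ (-a)) (volume : Measure ℝ) :=
        integrable_one_add_norm (by simp; linarith)
      exact (h1.const_mul M).integrableOn
    refine Integrable.mono' hG (h2 ω₂ lam β γ hω hl hβ hγ T hT N).1 ?_
    rw [ae_restrict_iff' measurableSet_Ioi]
    refine ae_of_all _ fun t ht => ?_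
    have ht' : (0 : ℝ) < t := ht
    rw [Real.norm_eq_abs, Real.norm_eq_abs, abs_of_pos ht']
    exact hpt N t ht'
  refine ⟨hint, ?_⟩
  -- the crossover exponent
  have ha1 : 0 < a - 1 := by linarith
  set θ : ℝ := (1 + 1 / (a - 1)) / 2 with hθ
  have hlt : 1 / (a - 1) < 1 := by rw [div_lt_one ha1]; linarith
  have hθ0 : 0 < θ := by positivity
  have hθ1 : θ < 1 := by rw [hθ]; linarith
  have hθa : 1 < θ * (a - 1) := by
    have : θ * (a - 1) = ((a - 1) + 1) / 2 := by rw [hθ]; field_simp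
    rw [this]; linarith
  have hcone := h4 ω₂ lam β γ hω hl hβ hγ T hT θ hθ0 hθ1
  have htail := tendsto_tail_aux (M := M) hθa
  -- the eventual bound `|N ∫ push| ≤ N ∫_{(0,N^θ]} |push| + M/(a-1) N^{-(θ(a-1)-1)}`
  have hbound : ∀ᶠ N : ℕ in atTop, ‖(N : ℝ) * ∫ t in Ioi (0 : ℝ), push ω₂ lam β γ N T t‖ ≤
      (N : ℝ) * (∫ t in Ioc (0 : ℝ) ((N : ℝ) ^ θ), |push ω₂ lam β γ N T t|) +
        M / (a - 1) * (N : ℝ) ^ (-(θ * (a - 1) - 1)) := by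
    filter_upwards [Filter.eventually_ge_atTop 1] with N hN
    have hN0 : (0 : ℝ) < N := by exact_mod_cast hN
    set c : ℝ := (N : ℝ) ^ θ with hc
    have hc0 : 0 < c := Real.rpow_pos_of_pos hN0 θ
    have hIabs : IntegrableOn (fun t => |push ω₂ lam β γ N T t|) (Ioi 0) := (hint N).abs
    -- split `(0,∞) = (0,c] ∪ (c,∞)`
    have hsplit : ∫ t in Ioi (0 : ℝ), |push ω₂ lam β γ N T t| =
        (∫ t in Ioc (0 : ℝ) c, |push ω₂ lam β γ N T t|) + ∫ t in Ioi c, |push ω₂ lam β γ N T t| := by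
      rw [← Set.Ioc_union_Ioi_eq_Ioi hc0.le,
        setIntegral_union (Set.Ioc_disjoint_Ioi_same) measurableSet_Ioi
          (hIabs.mono_set Ioc_subset_Ioi_self) (hIabs.mono_set (Ioi_subset_Ioi hc0.le))]
    -- tail: `∫_{(c,∞)} |push| ≤ M c^{1-a}/(a-1) = M/(a-1) · N^{θ(1-a)}`
    have hpow : IntegrableOn (fun t : ℝ => M * t ^ (-a)) (Ioi c) :=
      (integrableOn_Ioi_rpow_of_lt (by linarith : -a < -1) hc0).const_mul M
    have htailN : ∫ t in Ioi c, |push ω₂ lam β γ N T t| ≤ M / (a - 1) * (N : ℝ) ^ (θ * (1 - a)) := by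
      have h1 : ∫ t in Ioi c, |push ω₂ lam β γ N T t| ≤ ∫ t in Ioi c, M * t ^ (-a) := by
        refine setIntegral_mono_on (hIabs.mono_set (Ioi_subset_Ioi hc0.le)) hpow measurableSet_Ioi ?_
        intro t ht
        exact hpt' N t (hc0.trans ht)
      have h2 : ∫ t in Ioi c, M * t ^ (-a) = M * (-c ^ (-a + 1) / (-a + 1)) := by
        rw [integral_const_mul, integral_Ioi_rpow_of_lt (by linarith : -a < -1) hc0]
      have hca : c ^ (-a + 1) = (N : ℝ) ^ (θ * (1 - a)) := by
        rw [hc, ← Real.rpow_mul hN0.le]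
        congr 1; ring
      have hne : (-a + 1) ≠ 0 := by linarith
      have hne' : (a - 1) ≠ 0 := by linarith
      have h3 : M * (-c ^ (-a + 1) / (-a + 1)) = M / (a - 1) * (N : ℝ) ^ (θ * (1 - a)) := by
        rw [hca]
        field_simp
        ring
      rw [← h3, ← h2]
      exact h1
    have hNpow : (N : ℝ) * (M / (a - 1) * (N : ℝ) ^ (θ * (1 - a))) =
        M / (a - 1) * (N : ℝ) ^ (-(θ * (a - 1) - 1)) := by
      rw [show -(θ * (a - 1) - 1) = θ * (1 - a) + 1 by ring, Real.rpow_add hN0, Real.rpow_one]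
      ring
    -- assemble
    rw [Real.norm_eq_abs, abs_mul, abs_of_pos hN0]
    have hstep1 : (N : ℝ) * |∫ t in Ioi (0 : ℝ), push ω₂ lam β γ N T t| ≤
        (N : ℝ) * ∫ t in Ioi (0 : ℝ), |push ω₂ lam β γ N T t| :=
      mul_le_mul_of_nonneg_left abs_integral_le_integral_abs hN0.le
    have hstep2 : (N : ℝ) * ∫ t in Ioi (0 : ℝ), |push ω₂ lam β γ N T t| =
        (N : ℝ) * (∫ t in Ioc (0 : ℝ) c, |push ω₂ lam β γ N T t|) +
          (N : ℝ) * ∫ t in Ioi c, |push ω₂ lam β γ N T t| := by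
      rw [hsplit, mul_add]
    have hstep3 : (N : ℝ) * ∫ t in Ioi c, |push ω₂ lam β γ N T t| ≤
        M / (a - 1) * (N : ℝ) ^ (-(θ * (a - 1) - 1)) := by
      rw [← hNpow]
      exact mul_le_mul_of_nonneg_left htailN hN0.le
    linarith
  refine squeeze_zero_norm' hbound ?_
  simpa using hcone.add htail

/-! ## Proved glue, part 2: the heating reduction — (B1) ∧ (H) ∧ (X) ⇒ crux BY NAME -/

/-- `integral_add` + `Tendsto.add`: under the split, `a_N = N(γ²/T²)∫heating + (γ²/T²)·N∫push → κ + 0`. -/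
theorem heatingReduction (hS : TotalVarianceSplit) (hH : HeatingLimit) (hP : PushNegligible) :
    CruxViaChannel := by
  intro ω₂ lam β γ hω hl hβ hγ T hT
  obtain ⟨κ, hκ, hint, hlim⟩ := hH ω₂ lam β γ hω hl hβ hγ T hT
  obtain ⟨hintP, hlimP⟩ := hP ω₂ lam β γ hω hl hβ hγ T hT
  refine ⟨κ, hκ, ?_⟩
  have key : ∀ N : ℕ, (N : ℝ) * (γ ^ 2 / T ^ 2) *
      (∫ t in Ioi (0 : ℝ), cumulantChannel ω₂ lam β γ N T t) =
      (N : ℝ) * (γ ^ 2 / T ^ 2) * (∫ t in Ioi (0 : ℝ), heating ω₂ lam β γ N T t) +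
        (γ ^ 2 / T ^ 2) * ((N : ℝ) * ∫ t in Ioi (0 : ℝ), push ω₂ lam β γ N T t) := by
    intro N
    have h1 : (∫ t in Ioi (0 : ℝ), cumulantChannel ω₂ lam β γ N T t) =
        ∫ t in Ioi (0 : ℝ), (heating ω₂ lam β γ N T t + push ω₂ lam β γ N T t) := by
      refine setIntegral_congr_fun measurableSet_Ioi fun t ht => ?_
      exact hS ω₂ lam β γ hω hl hβ hγ T hT N t ht
    rw [h1, integral_add (hint N) (hintP N)]
    ring
  simp_rw [key]
  simpa using hlim.add (hlimP.const_mul (γ ^ 2 / T ^ 2))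

/-! ## The composition: the six stubs imply the crux, BY NAME (kernel-checked; no `sorry` below) -/

/-- **`IncoherentChannel_of`** — the glue of the line: the push term is disposed of by causality ×
forgetting (`pushNegligible_of`, stubs 2–4), the heating term carries `κ` (stub 6, fed by the contact
representation stub 5), and the split (stub 1) adds them up (`heatingReduction`); `crux_iff` is `Iff.rfl`. -/
theorem IncoherentChannel_of (h1 : Registered.stub_totalVarianceSplit) (h2 : Registered.stub_pushEnvelope)
    (h3 : Registered.stub_forecastEnvelope) (h4 : Registered.stub_sublinearCone)
    (h5 : Registered.stub_contactLeibnizDefect) (h6 : Registered.stub_heatingLimit) :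
    Summit.AtomisticToContinuum.FouriersLaw.Theses.PhononMeanFreePath.IncoherentChannel :=
  crux_iff.mp (heatingReduction h1 (h6 h5) (pushNegligible_of h2 h3 h4))

/-- Wiring check: the registered stubs feed `IncoherentChannel_of` as stated. -/
example : Summit.AtomisticToContinuum.FouriersLaw.Theses.PhononMeanFreePath.IncoherentChannel :=
  IncoherentChannel_of stub_totalVarianceSplit stub_pushEnvelope stub_forecastEnvelope stub_sublinearCone
    stub_contactLeibnizDefect stub_heatingLimit

end Summit.AtomisticToContinuum.FouriersLaw.Cruxes.IncoherentChannel.ForgettingBeforeHearing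

end
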